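import Summits.Ventures.QEC.CircuitDistance.PortTranslate
import Summits.Ventures.QEC.CircuitDistance.PortColumns
import Summits.Ventures.QEC.CircuitDistance.PortFibreReduction
import HarnessLib

/-!
# P3-PORT (E3): the index-0 `X`-SECTOR TABLE — format, decidable correctness, and what it certifies about every column
# (cell `qec`, experiment CDX, seat qec-cdx-type-1)

* `XTable` (42 rows per code: in-cycle `Z`-check flips `muZ`, residual support `ex`, class `cls` = generator SUPPORT or
  `none`, stabiliser certificate `cert` = `X`-check rows), `indic`, `trQ`;
* Bool checkers `XTable.shapeRow` (one-cycle simulation at base index 0, cycle 1 — `decide`, ≈ 2 s/kind) and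
  `XTable.classRow` (table arithmetic), predicates `ShapeCorrect`/`ClassCorrect`;
* consequences for EVERY fault of the circuit (via `shape_translate`, `shape_retag`, `xColumn_eq_of_xKind`):
  `mZ_of_table`, `dataXb_of_table`, `ancZx_kind`, and the FAST COLUMN `XTable.detFast` with **`detFast_eq_xDet`**
  (= the true `Z`-detector set `xDet` of the representative fault);
* **`classHyp_xDEM`**: shape- and class-correct table ⇒ `Fibre.ClassHyp` for the `X`-sector DEM `xDEM`.
Nothing here asserts a value of `d_circ`.
-/

namespace Summit.Ventures.QEC.CircuitDistance

open Literature.InformationTheory.QuantumCodes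

variable {ℓ m : ℕ}

/-- `X`-SECTOR TABLE at base index `0`, cycle `1`: per kind its in-cycle `Z`-check flips `muZ`, the support `ex` of its
residual `X`-error, its CLASS (support of the extended-code generator it realises, or `none` = null) and a stabiliser
CERTIFICATE (`X`-check rows whose sum is `ex − gen`). -/
structure XTable (ℓ m : ℕ) where
  /-- in-cycle `Z`-check outcome flips of the kind at base index 0, cycle 1 -/
  muZ : XKind → Finset (BB.Mono ℓ m)
  /-- support of the residual data `X`-error -/
  ex : XKind → Finset (BB.Mono ℓ m ⊕ BB.Mono ℓ m)
  /-- class: generator support, or `none` -/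
  cls : XKind → Option (Finset (BB.Mono ℓ m ⊕ BB.Mono ℓ m))
  /-- stabiliser certificate: `X`-check rows -/
  cert : XKind → Finset (BB.Mono ℓ m)

/-- Indicator vector of a finite set of qubits. -/
def indic (s : Finset (BB.Mono ℓ m ⊕ BB.Mono ℓ m)) : BB.Mono ℓ m ⊕ BB.Mono ℓ m → ZMod 2 := fun q => if q ∈ s then 1 else 0

variable [NeZero ℓ] [NeZero m]

/-- Translate a set of qubits by `t` (both blocks). -/
def trQ (t : BB.Mono ℓ m) (s : Finset (BB.Mono ℓ m ⊕ BB.Mono ℓ m)) : Finset (BB.Mono ℓ m ⊕ BB.Mono ℓ m) :=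
  s.map (BB.Code.translate t).toEmbedding

/-- Membership in a translated set. -/
theorem mem_trQ (t : BB.Mono ℓ m) (s : Finset (BB.Mono ℓ m ⊕ BB.Mono ℓ m)) (q : BB.Mono ℓ m ⊕ BB.Mono ℓ m) :
    q ∈ trQ t s ↔ (BB.Code.translate t).symm q ∈ s := by
  unfold trQ; rw [Finset.mem_map_equiv]

/-- The inverse translation on the left block. -/
theorem translate_symm_inl (t i : BB.Mono ℓ m) : (BB.Code.translate t).symm (Sum.inl i) = Sum.inl (i + -t) := rfl

/-- The inverse translation on the right block. -/
theorem translate_symm_inr (t i : BB.Mono ℓ m) : (BB.Code.translate t).symm (Sum.inr i) = Sum.inr (i + -t) := rfl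

/-- Translating twice. -/
theorem trQ_add (a b : BB.Mono ℓ m) (s : Finset (BB.Mono ℓ m ⊕ BB.Mono ℓ m)) : trQ (a + b) s = trQ b (trQ a s) := by
  ext q
  simp only [mem_trQ]
  have e : ∀ i : BB.Mono ℓ m, i + -(a + b) = i + -b + -a := fun i => by abel
  rcases q with i | i
  · rw [translate_symm_inl, translate_symm_inl, translate_symm_inl, e]
  · rw [translate_symm_inr, translate_symm_inr, translate_symm_inr, e]

/-- SHAPE CORRECTNESS of one row (decidable: a one-cycle simulation at base index `0`, cycle `1`). -/
def XTable.shapeRow (S : SMCode ℓ m) (T : XTable ℓ m) (k : XKind) : Bool :=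
  ((monoList ℓ m).all fun j => (shape S (k.fault 1 (0 : BB.Mono ℓ m))).mZ 1 j == decide (j ∈ T.muZ k)) &&
  ((monoList ℓ m).all fun a => ((shape S (k.fault 1 (0 : BB.Mono ℓ m))).frame.dataXb (.inl a) == decide (.inl a ∈ T.ex k)) &&
    ((shape S (k.fault 1 (0 : BB.Mono ℓ m))).frame.dataXb (.inr a) == decide (.inr a ∈ T.ex k)))

/-- SHAPE CORRECTNESS of the table: every listed kind's row. -/
def XTable.ShapeCorrect (S : SMCode ℓ m) (T : XTable ℓ m) : Prop := ∀ k ∈ XKind.all, T.shapeRow S k = true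

/-- CLASS CORRECTNESS of one row (decidable table arithmetic): `indic ex = indic cls + Σ_{cert} H^X-rows`. -/
def XTable.classRow (S : SMCode ℓ m) (T : XTable ℓ m) (k : XKind) : Bool :=
  decide (indic (T.ex k) = indic ((T.cls k).getD ∅) + ∑ r ∈ T.cert k, fun q => S.toCode.HX r q)

/-- CLASS CORRECTNESS of the table. -/
def XTable.ClassCorrect (S : SMCode ℓ m) (T : XTable ℓ m) : Prop := ∀ k ∈ XKind.all, T.classRow S k = true

/-- What a correct shape row says. -/
theorem XTable.shapeRow_spec {S : SMCode ℓ m} {T : XTable ℓ m} {k : XKind} (h : T.shapeRow S k = true) :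
    (∀ j, (shape S (k.fault 1 (0 : BB.Mono ℓ m))).mZ 1 j = decide (j ∈ T.muZ k)) ∧
    (∀ q, (shape S (k.fault 1 (0 : BB.Mono ℓ m))).frame.dataXb q = decide (q ∈ T.ex k)) := by
  unfold XTable.shapeRow at h
  simp only [Bool.and_eq_true, List.all_eq_true, beq_iff_eq] at h
  obtain ⟨h1, h2⟩ := h
  refine ⟨fun j => h1 j (mem_monoList j), fun q => ?_⟩
  rcases q with a | a
  · exact (h2 a (mem_monoList a)).1
  · exact (h2 a (mem_monoList a)).2

/-- Shapes of arbitrary representatives from the table: in-cycle `Z`-flips. -/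
theorem XTable.mZ_of_table {S : SMCode ℓ m} {T : XTable ℓ m} {k : XKind} (h : T.shapeRow S k = true) (c : ℕ)
    (i j : BB.Mono ℓ m) : (shape S (k.fault c i)).mZ c j = decide (j - i ∈ T.muZ k) := by
  rw [XKind.fault_eq_translate, shape_translate, XKind.fault_eq_retag, shape_retag]
  simp only [State.translate, XKind.cyc_fault, if_true]
  exact (XTable.shapeRow_spec h).1 (j - i)

/-- Shapes of arbitrary representatives from the table: `Z`-flips outside the own cycle vanish. -/
theorem XTable.mZ_of_table_ne {S : SMCode ℓ m} {k : XKind} {c t : ℕ} (ht : t ≠ c) (i j : BB.Mono ℓ m) :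
    (shape S (k.fault c i)).mZ t j = false :=
  shape_mZ_of_ne S _ (by rw [XKind.cyc_fault]; exact ht) j

/-- Shapes of arbitrary representatives from the table: residual support. -/
theorem XTable.dataXb_of_table {S : SMCode ℓ m} {T : XTable ℓ m} {k : XKind} (h : T.shapeRow S k = true) (c : ℕ)
    (i : BB.Mono ℓ m) (q : BB.Mono ℓ m ⊕ BB.Mono ℓ m) :
    (shape S (k.fault c i)).frame.dataXb q = decide (q ∈ trQ i (T.ex k)) := by
  rw [XKind.fault_eq_translate, shape_translate, dataXb_translate, XKind.fault_eq_retag, shape_retag]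
  exact ((XTable.shapeRow_spec h).2 _).trans (decide_eq_decide.mpr (mem_trQ i _ q).symm)

/-- The `ζ`-bit of a representative: only the `InitZ` kind, only on its own ancilla. -/
theorem ancZx_kind (S : SMCode ℓ m) (k : XKind) (c : ℕ) (i j : BB.Mono ℓ m) :
    (shape S (k.fault c i)).frame.ancZx j = (decide (k = .initZ) && decide (j = i)) := by
  rw [shape_ancZx, XKind.cyc_fault]
  cases k with
  | cnot lay bc bt => simp [XKind.fault]
  | idle s => simp [XKind.fault]
  | initZ =>
    by_cases hj : j = i
    · subst hj; simp [XKind.fault]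
    · simp [XKind.fault, hj, Ne.symm hj]
  | measZ => simp [XKind.fault]

/-! ## The fast column -/

/-- The detector encoding of the leaves: `(layer − 1)·(ℓm) + (a·m + b)`. -/
def encDet (p : ℕ × BB.Mono ℓ m) : ℕ := p.1 * (ℓ * m) + (BB.Code.checkIndex p.2 : ℕ)

omit [NeZero ℓ] [NeZero m] in
/-- The detector encoding is injective. -/
theorem encDet_injective : Function.Injective (encDet (ℓ := ℓ) (m := m)) := by
  intro p q h
  unfold encDet at h
  have hp := (BB.Code.checkIndex p.2).2
  have hq := (BB.Code.checkIndex q.2).2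
  have h1 : p.1 = q.1 := by
    rcases Nat.lt_trichotomy p.1 q.1 with hlt | heq | hgt
    · have : (p.1 + 1) * (ℓ * m) ≤ q.1 * (ℓ * m) := Nat.mul_le_mul_right _ hlt
      rw [Nat.add_mul, one_mul] at this; omega
    · exact heq
    · have : (q.1 + 1) * (ℓ * m) ≤ p.1 * (ℓ * m) := Nat.mul_le_mul_right _ hgt
      rw [Nat.add_mul, one_mul] at this; omega
  have h2 : (BB.Code.checkIndex p.2 : ℕ) = BB.Code.checkIndex q.2 := by rw [h1] at h; omega
  have h3 : p.2 = q.2 := BB.Code.checkIndex.injective (Fin.ext h2)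
  exact Prod.ext h1 h3

/-- The true `X`-column detector set of a fault: `{(t − 1, j) : detZ S Nc {f} t j}`. -/
def xDet (S : SMCode ℓ m) (Nc : ℕ) (f : Fault ℓ m) : Finset (ℕ × BB.Mono ℓ m) :=
  ((Finset.range (Nc + 2)) ×ˢ (Finset.univ : Finset (BB.Mono ℓ m))).filter fun p => detZ S Nc {f} (p.1 + 1) p.2

/-- The column FORMULA of `detZ_singleton` evaluated on table data: kind `k`, base index `i`, cycle `c`, entry
`(layer − 1, check) = (s, j)`. -/
def XTable.colFormula (S : SMCode ℓ m) (T : XTable ℓ m) (Nc : ℕ) (k : XKind) (i : BB.Mono ℓ m) (c s : ℕ)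
    (j : BB.Mono ℓ m) : Bool :=
  let μ := decide (j - i ∈ T.muZ k)
  let σ := synZ S (fun q => decide (q ∈ trQ i (T.ex k))) j
  let ζ := decide (k = .initZ) && decide (j = i)
  xor (xor (decide (s + 1 = c) && μ)
    (decide (s + 1 = c + 1) && xor (xor μ σ) (decide (c + 1 ≤ Nc) && ζ)))
    (decide (s + 1 = c + 2) && (decide (c + 1 ≤ Nc) && ζ))

/-- FAST `X`-COLUMN: the `Z`-check detectors `(layer − 1, check)` of kind `k` at base index `i`, cycle `c`, in the
`Nc`-cycle circuit, read off the table (only layers `c−1, c, c+1` can occur). -/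
def XTable.detFast (S : SMCode ℓ m) (T : XTable ℓ m) (Nc : ℕ) (k : XKind) (i : BB.Mono ℓ m) (c : ℕ) :
    Finset (ℕ × BB.Mono ℓ m) :=
  (({c - 1, c, c + 1} : Finset ℕ) ×ˢ (Finset.univ : Finset (BB.Mono ℓ m))).filter fun p => T.colFormula S Nc k i c p.1 p.2

/-- The formula IS the column of the representative (shape-correct row, fault inside the circuit). -/
theorem XTable.colFormula_eq {S : SMCode ℓ m} {T : XTable ℓ m} {k : XKind} (h : T.shapeRow S k = true) (Nc : ℕ)
    (i : BB.Mono ℓ m) (c : ℕ) (h₁ : 1 ≤ c) (h₂ : c ≤ Nc) (s : ℕ) (j : BB.Mono ℓ m) :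
    T.colFormula S Nc k i c s j = detZ S Nc {k.fault c i} (s + 1) j := by
  have hc : (k.fault c i : Fault ℓ m).cyc = c := XKind.cyc_fault k c i
  rw [detZ_singleton S Nc (k.fault c i) (by rw [hc]; exact h₁) (by rw [hc]; exact h₂), hc, XTable.mZ_of_table h c i j,
    ancZx_kind]
  have hd : (shape S (k.fault c i)).frame.dataXb = fun q => decide (q ∈ trQ i (T.ex k)) :=
    funext fun q => XTable.dataXb_of_table h c i q
  rw [hd]
  rfl

/-- **The fast column is the column.** -/
theorem XTable.detFast_eq_xDet {S : SMCode ℓ m} {T : XTable ℓ m} {k : XKind} (h : T.shapeRow S k = true) (Nc : ℕ)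
    (i : BB.Mono ℓ m) (c : ℕ) (h₁ : 1 ≤ c) (h₂ : c ≤ Nc) : T.detFast S Nc k i c = xDet S Nc (k.fault c i) := by
  ext ⟨s, j⟩
  simp only [XTable.detFast, xDet, Finset.mem_filter, Finset.mem_product, Finset.mem_univ, and_true, Finset.mem_range,
    Finset.mem_insert, Finset.mem_singleton, XTable.colFormula_eq h Nc i c h₁ h₂]
  constructor
  · rintro ⟨hs, hd⟩
    refine ⟨?_, hd⟩
    rcases hs with rfl | rfl | rfl
    · omega
    · omega
    · -- layer c+2 fires only through ζ, which needs c+1 ≤ Nc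
      have hc : (k.fault c i : Fault ℓ m).cyc = c := XKind.cyc_fault k c i
      rw [detZ_singleton S Nc (k.fault c i) (by rw [hc]; exact h₁) (by rw [hc]; exact h₂), hc] at hd
      by_contra hN
      have e1 : ¬ (c + 1 + 1 = c) := by omega
      have e2 : ¬ (c + 1 + 1 = c + 1) := by omega
      have e3 : ¬ (c + 1 ≤ Nc) := by omega
      rw [decide_eq_false e1, decide_eq_false e2, decide_eq_false e3] at hd
      simp at hd
  · rintro ⟨hs, hd⟩
    refine ⟨?_, hd⟩
    have hc : (k.fault c i : Fault ℓ m).cyc = c := XKind.cyc_fault k c i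
    rw [detZ_singleton S Nc (k.fault c i) (by rw [hc]; exact h₁) (by rw [hc]; exact h₂), hc] at hd
    by_contra hne
    push Not at hne
    have e1 : ¬ (s + 1 = c) := by omega
    have e2 : ¬ (s + 1 = c + 1) := by omega
    have e3 : ¬ (s + 1 = c + 2) := by omega
    rw [decide_eq_false e1, decide_eq_false e2, decide_eq_false e3] at hd
    simp at hd

/-! ## The `X`-sector DEM and its class hypothesis -/

/-- `X`-NONTRIVIAL residual: zero `Z`-syndrome and not an `X`-stabiliser. -/
def XNontrivial (S : SMCode ℓ m) (v : BB.Mono ℓ m ⊕ BB.Mono ℓ m → ZMod 2) : Prop :=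
  S.toCode.HZ.mulVec v = 0 ∧ v ∉ rowSpace S.toCode.HX

/-- The scope of the `Nc`-cycle circuit: faults in cycles `1 … Nc`. -/
def scope (Nc : ℕ) : Set (Fault ℓ m) := {f | 1 ≤ f.cyc ∧ f.cyc ≤ Nc}

/-- The `X`-sector DEM of the `Nc`-cycle circuit with classes read off the table `T` (translated from base index 0). -/
def xDEM (S : SMCode ℓ m) (T : XTable ℓ m) (Nc : ℕ) :
    Fibre.DEM (Fault ℓ m) (ℕ × BB.Mono ℓ m) (Finset (BB.Mono ℓ m ⊕ BB.Mono ℓ m)) (BB.Mono ℓ m ⊕ BB.Mono ℓ m → ZMod 2) where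
  det := xDet S Nc
  res := fun f => dataX S Nc {f}
  cls := fun f => f.xKind.bind fun ki => (T.cls ki.1).map (trQ ki.2)
  gen := indic
  stab := rowSpace S.toCode.HX

/-- A row of `H^X` is an `X`-stabiliser. -/
theorem HX_row_mem_rowSpace (S : SMCode ℓ m) (r : BB.Mono ℓ m) : (fun q => S.toCode.HX r q) ∈ rowSpace S.toCode.HX := by
  refine mem_rowSpace_of_vecMul_eq (Pi.single r 1) ?_
  funext q
  rw [Matrix.vecMul, dotProduct]
  simp only [Pi.single_apply]
  rw [Finset.sum_eq_single r]
  · simp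
  · intro b _ hb; simp [hb]
  · intro h; exact absurd (Finset.mem_univ r) h

/-- Translating the table identity: the residual support of a representative at base index `i`. -/
theorem indic_trQ (t : BB.Mono ℓ m) (s : Finset (BB.Mono ℓ m ⊕ BB.Mono ℓ m)) :
    indic (trQ t s) = fun q => indic s ((BB.Code.translate t).symm q) := by
  funext q; unfold indic; exact if_congr (mem_trQ t s q) rfl rfl

/-- A translated `H^X` row is an `H^X` row. -/
theorem HX_row_translate (S : SMCode ℓ m) (r t : BB.Mono ℓ m) :
    (fun q => S.toCode.HX r ((BB.Code.translate t).symm q)) = fun q => S.toCode.HX (r + t) q := by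
  funext q
  have := BB.Code.HX_translate S.toCode t r ((BB.Code.translate t).symm q)
  rw [Equiv.apply_symm_apply] at this
  exact this.symm

/-- **Class hypothesis of the `X`-sector DEM** from a shape- and class-correct table. -/
theorem classHyp_xDEM (S : SMCode ℓ m) (T : XTable ℓ m) (hS : T.ShapeCorrect S) (hC : T.ClassCorrect S) (Nc : ℕ) :
    Fibre.ClassHyp (xDEM S T Nc) (scope Nc) := by
  intro f hf
  obtain ⟨h₁, h₂⟩ := hf
  -- the residual of `f` from the table
  rcases hk : f.xKind with _ | ⟨k, i⟩
  · -- no X-part: zero residual, null class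
    have h0 := (xColumn_zero_of_xKind S Nc f hk).2
    refine ⟨fun _ => ?_, fun g hg => ?_⟩
    · show dataX S Nc {f} ∈ rowSpace S.toCode.HX; rw [h0]; exact Submodule.zero_mem _
    · simp [xDEM, hk] at hg
  · have hkall : k ∈ XKind.all := XKind.mem_all k (fun lay => Fault.xKind_ne_zero hk lay)
    have hrow := hS k hkall
    have hcls := hC k hkall
    unfold XTable.classRow at hcls
    rw [decide_eq_true_eq] at hcls
    -- res f = indic (trQ i (ex k))
    have hres : dataX S Nc {f} = indic (trQ i (T.ex k)) := by
      rw [(xColumn_eq_of_xKind S Nc f hk).2, dataX_singleton S Nc (k.fault f.cyc i) (by rw [XKind.cyc_fault]; exact h₁)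
        (by rw [XKind.cyc_fault]; exact h₂)]
      funext q; unfold toZ2 indic; rw [XTable.dataXb_of_table hrow]
      by_cases hq : q ∈ trQ i (T.ex k) <;> simp [hq]
    -- translate the class identity
    have hsum : indic (trQ i (T.ex k)) = indic (trQ i ((T.cls k).getD ∅)) + ∑ r ∈ T.cert k, fun q => S.toCode.HX (r + i) q := by
      rw [indic_trQ, indic_trQ, hcls]
      funext q
      simp only [Pi.add_apply, Finset.sum_apply]
      congr 1
      apply Finset.sum_congr rfl
      intro r _
      exact congrFun (HX_row_translate S r i) q
    have hstab : (∑ r ∈ T.cert k, fun q => S.toCode.HX (r + i) q) ∈ rowSpace S.toCode.HX :=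
      Submodule.sum_mem _ fun r _ => HX_row_mem_rowSpace S (r + i)
    refine ⟨fun hnone => ?_, fun g hg => ?_⟩
    · -- null class
      simp only [xDEM, hk, Option.bind_some] at hnone
      rw [Option.map_eq_none_iff] at hnone
      show dataX S Nc {f} ∈ rowSpace S.toCode.HX
      rw [hres, hsum, hnone]
      simp only [Option.getD_none]
      have : indic (trQ i (∅ : Finset (BB.Mono ℓ m ⊕ BB.Mono ℓ m))) = 0 := by
        funext q; simp [indic, trQ]
      rw [this, zero_add]; exact hstab
    · simp only [xDEM, hk, Option.bind_some] at hg
      obtain ⟨g₀, hg₀, rfl⟩ := Option.map_eq_some_iff.1 hg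
      show dataX S Nc {f} - indic (trQ i g₀) ∈ rowSpace S.toCode.HX
      rw [hres, hsum, hg₀]
      simp only [Option.getD_some, add_sub_cancel_left]
      exact hstab

end Summit.Ventures.QEC.CircuitDistance
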